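import Summits.Ventures.CertifiedManyBodySolver.Downfold.EmeryBoxesLa214CLDAThermalCapRetiltMarkovBoxp1
import Summits.Ventures.CertifiedManyBodySolver.Downfold.EmeryBoxesLa214CLDAThermalFloorAtlasWord
import Summits.Ventures.CertifiedManyBodySolver.Downfold.EmeryThermalAtomicFloor
import HarnessLib

/-!
# HIGH-TEMPERATURE-CLOSING `T > 0` WINDOW on La2CuO4 (M13) U-SLICE «cLDA» (U_dd, U_pp) = (10.5, 4.0) [HSC89] — `emeryBoxLa214CLDA` (router/EMERY-FLOOR-ORDERS row 3): the ATOMIC-LIMIT floor (full entropy) ∨ the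
# family floor, against the re-tilted cap — both sides meet at `6 log 2` as β → 0

Venture CertifiedManyBodySolver, cell `pub/hubbard-downfold` (S1 = ROUTER) × crew hubbard-fast S2 (ii) × (iv) «T > 0 × multi-band» (D-0096 (ii)); seat hubbard-downfold-mod-4
(S1/S2 Emery seam, g17). Namespace `Summit.Ventures.CertifiedManyBodySolver.Downfold`. DOOR: `EmeryThermalAtomicFloor` (`holdsOn_emeryCellPressureAtomicFloor`: Peierls on the
whole occupation basis of the `Cu₄O₈` block, site-wise factorisation; the one-site function is the tree's `atomicPartitionFnReal β U μ`). INPUTS BY NAME: the family floor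
`emeryBoxLa214CLDA_pressureFloorFam_m44o5` (`EmeryBoxesLa214CLDAThermalFloorAtlasWord`; C = (-145.929466, -147.829591, -145.996801)), the cap `emeryBoxLa214CLDA_pressureCap_m44o5_retilt` (`EmeryBoxesLa214CLDAThermalCapRetiltMarkovBoxp1`; `6 log 2 + 43.1664·β`; flat word 47.9957).
ATOMIC DATA: Cu at `μ_d = −(εp + Δ_hi) = 449/50`, `U_d,hi = 21/2`; O at `μ_p = −εp = 44/5`, `U_p,hi = 4` ⇒ classical slope 36.1800·β (family slope 36.9574; cap 43.1664).
RESULT: **`emeryBoxLa214CLDA_pressureWindowHighT_m44o5`**: `max(atomic, family) ≤ P_cell ≤ 6 log 2 + 43.1664·β` on the whole box, every β ≥ 0; width → 0 as β → 0 (both sides `6 log 2`,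
`emeryBoxLa214CLDA_pressure_beta_zero_m44o5`); crossover β* ≈ 0.985 (T* ≈ 11787 K) below which the atomic floor is the better floor [float].

Everything PROVED (0 sorry); no definition. HONEST FRAMING: CERTIFIED inequalities on a SCREENING/EXTRAPOLATED-grade object; the atomic floor ignores hopping (its slope sits
0.7774 below the family floor's), so at physical temperatures (β ≈ 20–40 eV⁻¹) the family floor still decides and thermal scales are NOT resolved there; what is new
is the correct INFINITE-TEMPERATURE closure of the window and a certified high-T regime (β ≲ β*) with width `≈ 6.9864·β`; grand-canonical at the stated level; no phase word;
no router number moves. WHAT-THIS-IS-NOT: a new certificate (pure algebra on landed objects; zero kit).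
-/

noncomputable section

namespace Summit.Ventures.CertifiedManyBodySolver.Downfold

open NonemptyInterval Matrix Finset Literature.Probability.LatticeModels
open Literature.MathematicalPhysics.QuantumLattice Literature.Computation.Certificates
open Summit.Ventures.CertifiedManyBodySolver.Certificates OccupationCode ClusterLowerBound
open scoped BigOperators ComplexOrder

/-! ## §1 The atomic-limit floor on the box at εp = -44/5 -/

/-- **ATOMIC-LIMIT `T > 0` FLOOR** on the whole `emeryBoxLa214CLDA`, cuprate signs, level εp = -44/5 (chemical potential 44/5 eV), EVERY β ≥ 0:
`log z₀(β; U_d = 21/2, μ_d = 449/50) + 2·log z₀(β; U_p = 4, μ_p = 44/5) ≤ P_cell` with `z₀(β; U, μ) = 1 + 2e^{βμ} + e^{−β(U−2μ)}` (`atomicPartitionFnReal`; Cu at the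
box's upper level `εp + Δ_hi = -449/50` and `U_d,hi`, O at `εp` and `U_p,hi`). Value `6 log 2` at β = 0; slope `36.1800·β` as β → ∞ (classical minimum, no hopping).
[cite: Ruelle1969, §2.5–2.6] [cite: Ueltschi1999, §3] -/
theorem emeryBoxLa214CLDA_pressureAtomicFloor_m44o5 {β : ℝ} (hβ : 0 ≤ β) :
    HoldsOn (fun p : EmeryCoord → ℝ => Real.log (atomicPartitionFnReal β (21/2 : ℝ) (449/50 : ℝ)) + 2 * Real.log (atomicPartitionFnReal β (4 : ℝ) (44/5 : ℝ)) ≤ emeryCellPressure β (emeryLine cuprateSigns (emeryLineCoords (((-44/5 : ℚ)) : ℝ) p))) emeryBoxLa214CLDA := by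
  intro p hp
  have h := holdsOn_emeryCellPressureAtomicFloor (E := emeryBoxLa214CLDA) (eA := la214Emery_tpd) (eB := la214Emery_tpp) (eD := la214CLDAEmery_Delta) (eUd := la214CLDAEmery_Udd) (eUp := la214CLDAEmery_Upp) (-44/5) (by simp [emeryBoxLa214CLDA, emeryBoxLa214CLDASrc, Function.update]) (by simp [emeryBoxLa214CLDA, emeryBoxLa214CLDASrc, Function.update]) (Function.update_self _ _ _) (by simp [emeryBoxLa214CLDA, emeryBoxLa214CLDASrc, Function.update]) (by simp [emeryBoxLa214CLDA, emeryBoxLa214CLDASrc, Function.update]) cuprateSigns hβ p hp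
  simp only [la214CLDAEmery_Delta, la214CLDAEmery_Udd, la214CLDAEmery_Upp, Entry.encl_ofEnds_snd] at h
  push_cast at h
  norm_num at h ⊢
  exact h

/-! ## §2 The best floor and the HIGH-TEMPERATURE-CLOSING window -/

/-- **BEST `T > 0` FLOOR = max(atomic, family)** on the whole box at εp = -44/5, every β ≥ 0: the atomic floor (full entropy, slope 36.1800) wins for
β < β* ≈ 0.985 (T > 11787 K), the family floor `emeryBoxLa214CLDA_pressureFloorFam_m44o5` (slope 36.9574, entropy ¼·log 3) for β > β*. [cite: Ruelle1969, §2.5–2.6] [cite: Israel1979, Lemma II.3.1] -/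
theorem emeryBoxLa214CLDA_pressureFloorBest_m44o5 {β : ℝ} (hβ : 0 ≤ β) :
    HoldsOn (fun p : EmeryCoord → ℝ => max (Real.log (atomicPartitionFnReal β (21/2 : ℝ) (449/50 : ℝ)) + 2 * Real.log (atomicPartitionFnReal β (4 : ℝ) (44/5 : ℝ))) (Real.log (Real.exp (-(β * (-72964733/500000 : ℝ))) + Real.exp (-(β * (-147829591/1000000 : ℝ))) + Real.exp (-(β * (-145996801/1000000 : ℝ)))) / 4) ≤ emeryCellPressure β (emeryLine cuprateSigns (emeryLineCoords (((-44/5 : ℚ)) : ℝ) p))) emeryBoxLa214CLDA :=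
  fun p hp => max_le (emeryBoxLa214CLDA_pressureAtomicFloor_m44o5 hβ p hp) (emeryBoxLa214CLDA_pressureFloorFam_m44o5 hβ p hp)

/-- **THE HIGH-TEMPERATURE-CLOSING TWO-SIDED `T > 0` WINDOW** (hypothesis-free on both sides) on the whole `emeryBoxLa214CLDA`, level εp = -44/5, EVERY β ≥ 0:
`max(atomic, family) ≤ P_cell ≤ 6 log 2 + β·215831797/5000000` (cap = `emeryBoxLa214CLDA_pressureCap_m44o5_retilt`, hubbard-box-p1 re-tilted). BOTH SIDES EQUAL `6 log 2` AT β = 0; the width is `O(β)` for small β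
(slope gap 6.9864 against the atomic floor, 6.2090 against the family floor). Table [float; `T = 11604.5/β` K]:
| β (1/eV) | T (K) | atomic floor | family floor | best floor | cap | width |
|---|---|---|---|---|---|---|
| 0.01 | 1160450 | 4.3815 | 0.6411 | 4.3815 | 4.5905 | 0.2090 |
| 0.1 | 116045 | 6.6296 | 3.9403 | 6.6296 | 8.4755 | 1.8459 |
| 0.5 | 23209 | 19.3332 | 18.6238 | 19.3332 | 25.7421 | 6.4089 |
| 1 | 11604 | 37.0096 | 37.0248 | 37.0248 | 47.3252 | 10.3004 |
| 2 | 5802 | 73.0771 | 73.9265 | 73.9265 | 90.4916 | 16.5651 |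
| 5 | 2321 | 181.5934 | 184.7870 | 184.7870 | 219.9907 | 35.2036 |
| 10 | 1160 | 362.4931 | 369.5740 | 369.5740 | 435.8225 | 66.2485 |
| 20 | 580 | 724.2931 | 739.1480 | 739.1480 | 867.4861 | 128.3381 |
| 40 | 290 | 1447.8931 | 1478.2959 | 1478.2959 | 1730.8133 | 252.5173 |
[cite: Israel1979, Thm. I.2.4] [cite: Ruelle1969, §2.5–2.6] [cite: Ueltschi1999, §3] -/
theorem emeryBoxLa214CLDA_pressureWindowHighT_m44o5 {β : ℝ} (hβ : 0 ≤ β) :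
    HoldsOn (fun p : EmeryCoord → ℝ =>
      max (Real.log (atomicPartitionFnReal β (21/2 : ℝ) (449/50 : ℝ)) + 2 * Real.log (atomicPartitionFnReal β (4 : ℝ) (44/5 : ℝ))) (Real.log (Real.exp (-(β * (-72964733/500000 : ℝ))) + Real.exp (-(β * (-147829591/1000000 : ℝ))) + Real.exp (-(β * (-145996801/1000000 : ℝ)))) / 4) ≤ emeryCellPressure β (emeryLine cuprateSigns (emeryLineCoords (((-44/5 : ℚ)) : ℝ) p)) ∧
      emeryCellPressure β (emeryLine cuprateSigns (emeryLineCoords (((-44/5 : ℚ)) : ℝ) p)) ≤ 6 * Real.log 2 + β * (215831797/5000000 : ℝ)) emeryBoxLa214CLDA :=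
  fun p hp => ⟨emeryBoxLa214CLDA_pressureFloorBest_m44o5 hβ p hp, by simpa using emeryBoxLa214CLDA_pressureCap_m44o5_retilt hβ p hp⟩

/-- **At β = 0 the window is a point**: `P_cell(0, ·) = 6 log 2` on the whole box (floor and cap coincide). [cite: Ueltschi1999, §3] -/
theorem emeryBoxLa214CLDA_pressure_beta_zero_m44o5 :
    HoldsOn (fun p : EmeryCoord → ℝ => emeryCellPressure 0 (emeryLine cuprateSigns (emeryLineCoords (((-44/5 : ℚ)) : ℝ) p)) = 6 * Real.log 2) emeryBoxLa214CLDA := by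
  intro p hp
  have h := emeryBoxLa214CLDA_pressureWindowHighT_m44o5 le_rfl p hp
  rw [atomicPartitionFnReal_beta_zero, atomicPartitionFnReal_beta_zero, show (4 : ℝ) = 2 ^ 2 by norm_num, Real.log_pow] at h
  simp only [Nat.cast_ofNat, zero_mul, add_zero] at h
  have h1 := (le_max_left _ _).trans h.1
  linarith [h.2]

end Summit.Ventures.CertifiedManyBodySolver.Downfold

end
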